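import Literature.Barriers.CriticalPhenomena.HaraGaussianLemmaConvolution
import HarnessLib

/-!
# Sakai 2007, Proposition 5.1: the convolution bound and the "star" bound for the regularised
# Riesz kernels `⟦x⟧^{-a}` (the analytic input of the `x`-space bounds on the Ising
# lace-expansion coefficients, Sakai 2007 Prop. 3.1 / Sakai 2022 §3)

Barrier catalogue `Literature/Barriers/CriticalPhenomena/` (D-0021), analysis support for the
spread-out Ising programme (`LaceExpansionIsingCoefficients.lean`: the named fact
`SpreadOutIsing.Sakai2007_prop31` = Sakai 2007, Proposition 3.1, the `x`-space bounds (3.3) on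
Sakai's coefficients `π^{(j)}_Λ`). The printed proof of Proposition 3.1 (Sakai 2007, §5.1;
re-derived from the corrected diagrammatic bounds in Sakai 2022, §3, Lemma 3.2 and Corollaries
3.3, 3.10, 3.14) bounds the diagrams by "repeated use" of two lattice-sum estimates, printed as
Proposition 5.1 of Sakai 2007:

* (5.1) [= Hara–van der Hofstad–Slade 2003, Prop. 1.7 (i)]: for `a ≥ b > 0`, `a + b > d`,
  `Σ_y ⟦y-v⟧^{-a} ⟦x-y⟧^{-b} ≤ C ⟦x-v⟧^{-((a ∧ d) + b - d)}`;
* (5.2) (the "star"): for `q ∈ (d/2, d)`,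
  `Σ_z ⟦x-z⟧^{-q}⟦x'-z⟧^{-q}⟦z-y⟧^{-q}⟦z-y'⟧^{-q} ≤ C' ⟦x-y⟧^{-q}⟦x'-y'⟧^{-q}`,
  "By the triangle inequality, `½⟦x-y⟧ ≤ ⟦x-z⟧ ∨ ⟦z-y⟧` … by (5.1) with `a = b = q` … where we
  note that `⟦x-x'⟧^{d-2q} ≤ 1` because of `d/2 < q`. The other three possible cases can be
  estimated similarly."

Here `⟦x⟧ = |x| ∨ 1` (`jnorm`, Euclidean norm). This file PROVES both, for the pure kernels
(which is how they are consumed: every line of a diagram is `O(θ₀)⟦·⟧^{-q}` or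
`δ + O(θ₀)⟦·⟧^{-q}`), in all the cases the Ising bounds use:

* `exists_conv_jnorm_le_of_lt_dim` — (5.1) for `a > d > b ≥ 0`: `≤ C⟦x⟧^{-b}` (the tree's
  `exists_convolution_bound_i`, Hara 2008 Lemma B.1 (i), specialised to the kernels);
* `exists_conv_jnorm_le_of_dim_lt` — (5.1) for `a ≥ b > d`: `≤ C⟦x⟧^{-b}` (e.g. `a = b = 2q`);
* `exists_conv_jnorm_le_rpow_sub` — (5.1) for `b ≤ a < d < a + b`: `≤ C⟦x⟧^{d-a-b}` (e.g.
  `a = b = q`, the "bubble" `⟦x⟧^{-(2q-d)}`), by the three regions `|y| ≤ |x|/2`,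
  `|x|/2 < |y| ≤ 2|x|`, `|y| > 2|x|`;
* the two-point (translated) forms `Σ_y ⟦y-v⟧^{-a}⟦x-y⟧^{-b}` (`tsum_conv_shift`);
* `jnorm_rpow_neg_mul_le_triangle` — the pointwise form of "`½⟦x-y⟧ ≤ ⟦x-z⟧ ∨ ⟦z-y⟧`":
  `⟦x-z⟧^{-q}⟦z-y⟧^{-q} ≤ 2^q⟦x-y⟧^{-q}(⟦x-z⟧^{-q} + ⟦z-y⟧^{-q})`;
* `exists_star_jnorm_le` — (5.2);
* the same bounds for the `ℝ≥0∞`-valued kernels `jker s x = ⟦x⟧^{-s}` (`tsum` without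
  summability side conditions), which is the currency of the diagram estimates downstream.

Constants depend on `d` and the exponents only. All statements are theorems; no named fact is
introduced.

## References

* A. Sakai, *Lace expansion for the Ising model*, Comm. Math. Phys. 272 (2007) 283–344,
  arXiv:math-ph/0510093: §3 (`⟦x⟧ = |x| ∨ 1`), Proposition 5.1 ((5.1)–(5.2)) and its proof
  [Sakai2007]. (Display numbers of the arXiv version, every display counted.)
* A. Sakai, *Correct bounds on the Ising lace-expansion coefficients*, Comm. Math. Phys. 392
  (2022) 783–823, arXiv:2003.09856: §3.1, (3.7) (the convolution bound "by repeated use of"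
  which Lemma 3.2 and Corollaries 3.3/3.10/3.14 are derived) [Sakai2022].
* T. Hara, R. van der Hofstad, G. Slade, Ann. Probab. 31 (2003) 349–408, Prop. 1.7 (i)
  [HaraHofstadSlade2003]; T. Hara, Ann. Probab. 36 (2008) 530–593, Lemma B.1 (i) [Hara2008].
-/

noncomputable section

namespace Literature.Barriers.CriticalPhenomena

open MeasureTheory Finset Literature.Probability.LatticeModels
open scoped ENNReal

variable {d : ℕ}

/-! ### Symmetries and the triangle inequality for `⟦·⟧` -/

/-- `⟦-x⟧ = ⟦x⟧`. [folklore] -/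
theorem jnorm_neg (x : Site d) : jnorm (-x) = jnorm x := by
  unfold jnorm; rw [euclidNorm_neg]

/-- `⟦x - y⟧ = ⟦y - x⟧`. [folklore] -/
theorem jnorm_sub_rev (x y : Site d) : jnorm (x - y) = jnorm (y - x) := by
  rw [← neg_sub, jnorm_neg]

/-- `⟦x⟧^{-s} ≤ 1` for `s ≥ 0`. [folklore] -/
theorem jnorm_rpow_neg_le_one (x : Site d) {s : ℝ} (hs : 0 ≤ s) : jnorm x ^ (-s) ≤ 1 :=
  Real.rpow_le_one_of_one_le_of_nonpos (one_le_jnorm x) (by linarith)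

/-- `⟦x⟧^{-a} ≤ ⟦x⟧^{-b}` for `b ≤ a`. [folklore] -/
theorem jnorm_rpow_neg_antitone (x : Site d) {a b : ℝ} (h : b ≤ a) : jnorm x ^ (-a) ≤ jnorm x ^ (-b) :=
  jnorm_rpow_le_rpow_of_le x (by linarith)

/-- The triangle inequality in the form used by Sakai: `⟦x - y⟧ ≤ 2 (⟦x - z⟧ ∨ ⟦z - y⟧)`
("`½⟦x-y⟧ ≤ ⟦x-z⟧ ∨ ⟦z-y⟧`"). [cite: Sakai2007, proof of Proposition 5.1] -/
theorem jnorm_sub_le_two_mul_max (x y z : Site d) :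
    jnorm (x - y) ≤ 2 * max (jnorm (x - z)) (jnorm (z - y)) := by
  have ht : euclidNorm (x - y) ≤ euclidNorm (x - z) + euclidNorm (z - y) := by
    have h := euclidNorm_add_le (x - z) (z - y)
    rwa [sub_add_sub_cancel] at h
  rcases le_total (euclidNorm (z - y)) (euclidNorm (x - z)) with h | h
  · have h2 : euclidNorm (x - y) ≤ 2 * euclidNorm (x - z) := by linarith
    calc jnorm (x - y) ≤ 2 * jnorm (x - z) := jnorm_le_mul_jnorm (by norm_num) h2
      _ ≤ 2 * max (jnorm (x - z)) (jnorm (z - y)) := by gcongr; exact le_max_left _ _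
  · have h2 : euclidNorm (x - y) ≤ 2 * euclidNorm (z - y) := by linarith
    calc jnorm (x - y) ≤ 2 * jnorm (z - y) := jnorm_le_mul_jnorm (by norm_num) h2
      _ ≤ 2 * max (jnorm (x - z)) (jnorm (z - y)) := by gcongr; exact le_max_right _ _

/-- **Pointwise form of the triangle inequality for the kernels** (Sakai's "Suppose that
`⟦x-z⟧ ≤ ⟦z-y⟧` … The other … cases can be estimated similarly"): for `q ≥ 0`,
`⟦x-z⟧^{-q}⟦z-y⟧^{-q} ≤ 2^q ⟦x-y⟧^{-q} (⟦x-z⟧^{-q} + ⟦z-y⟧^{-q})`.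
[cite: Sakai2007, proof of Proposition 5.1] -/
theorem jnorm_rpow_neg_mul_le_triangle (x y z : Site d) {q : ℝ} (hq : 0 ≤ q) :
    jnorm (x - z) ^ (-q) * jnorm (z - y) ^ (-q) ≤
      2 ^ q * jnorm (x - y) ^ (-q) * (jnorm (x - z) ^ (-q) + jnorm (z - y) ^ (-q)) := by
  have h1 : 0 ≤ jnorm (x - z) ^ (-q) := Real.rpow_nonneg (jnorm_pos _).le _
  have h2 : 0 ≤ jnorm (z - y) ^ (-q) := Real.rpow_nonneg (jnorm_pos _).le _
  have h3 : 0 ≤ 2 ^ q * jnorm (x - y) ^ (-q) := mul_nonneg (by positivity) (Real.rpow_nonneg (jnorm_pos _).le _)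
  have hmax := jnorm_sub_le_two_mul_max x y z
  rcases le_total (jnorm (z - y)) (jnorm (x - z)) with h | h
  · rw [max_eq_left h] at hmax
    have hb := jnorm_rpow_neg_le_of_jnorm_le (by norm_num : (0:ℝ) < 2) hq hmax
    calc jnorm (x - z) ^ (-q) * jnorm (z - y) ^ (-q)
        ≤ (2 ^ q * jnorm (x - y) ^ (-q)) * jnorm (z - y) ^ (-q) := mul_le_mul_of_nonneg_right hb h2
      _ ≤ 2 ^ q * jnorm (x - y) ^ (-q) * (jnorm (x - z) ^ (-q) + jnorm (z - y) ^ (-q)) := by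
          refine mul_le_mul_of_nonneg_left ?_ h3
          linarith
  · rw [max_eq_right h] at hmax
    have hb := jnorm_rpow_neg_le_of_jnorm_le (by norm_num : (0:ℝ) < 2) hq hmax
    calc jnorm (x - z) ^ (-q) * jnorm (z - y) ^ (-q)
        ≤ jnorm (x - z) ^ (-q) * (2 ^ q * jnorm (x - y) ^ (-q)) := mul_le_mul_of_nonneg_left hb h1
      _ = (2 ^ q * jnorm (x - y) ^ (-q)) * jnorm (x - z) ^ (-q) := by ring
      _ ≤ 2 ^ q * jnorm (x - y) ^ (-q) * (jnorm (x - z) ^ (-q) + jnorm (z - y) ^ (-q)) := by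
          refine mul_le_mul_of_nonneg_left ?_ h3
          linarith

/-! ### Reindexing of lattice convolutions -/

/-- `Σ_y f(y) g(x - y) = Σ_y f(x - y) g(y)`. [folklore] -/
theorem tsum_conv_comm (f g : Site d → ℝ) (x : Site d) :
    ∑' y, f y * g (x - y) = ∑' y, f (x - y) * g y := by
  rw [← tsum_comp_sub_left (fun y => f y * g (x - y)) x]
  exact tsum_congr fun y => by rw [sub_sub_cancel]

/-- Translating the base point: `Σ_y f(y - v) g(x - y) = Σ_z f(z) g((x - v) - z)`. [folklore] -/
theorem tsum_conv_shift (f g : Site d → ℝ) (x v : Site d) :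
    ∑' y, f (y - v) * g (x - y) = ∑' z, f z * g (x - v - z) := by
  rw [← (Equiv.subRight v).tsum_eq (fun z => f z * g (x - v - z))]
  exact tsum_congr fun y => by simp [sub_sub_sub_cancel_right]

/-- Summability is invariant under the same translation. [folklore] -/
theorem summable_conv_shift {f g : Site d → ℝ} {x v : Site d}
    (h : Summable fun z => f z * g (x - v - z)) : Summable fun y => f (y - v) * g (x - y) := by
  have := (Equiv.subRight v).summable_iff.2 h
  refine this.congr fun y => ?_
  simp [sub_sub_sub_cancel_right]

/-! ### Sakai 2007, Proposition 5.1 (5.1): the convolution bound -/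

/-- **(5.1), case `a > d > b ≥ 0`** (= HHS 2003, Prop. 1.7 (i); Hara 2008, Lemma B.1 (i)):
`Σ_y ⟦x-y⟧^{-a}⟦y⟧^{-b} ≤ C⟦x⟧^{-b}`. [cite: Sakai2007, Proposition 5.1 (5.1)]
[cite: HaraHofstadSlade2003, Prop. 1.7 (i)] -/
theorem exists_conv_jnorm_le_of_lt_dim (hd : 1 ≤ d) {a b : ℝ} (ha : (d : ℝ) < a) (hb0 : 0 ≤ b)
    (hbd : b < d) :
    ∃ C : ℝ, 0 ≤ C ∧ ∀ x : Site d, ∑' y, jnorm (x - y) ^ (-a) * jnorm y ^ (-b) ≤ C * jnorm x ^ (-b) := by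
  obtain ⟨C, hC, h⟩ := exists_convolution_bound_i hd ha hb0 hbd
  refine ⟨C, hC, fun x => ?_⟩
  have h1 := h (fun y => jnorm y ^ (-a)) (fun y => jnorm y ^ (-b)) 1 1
    (fun y => by rw [one_mul, abs_of_nonneg (Real.rpow_nonneg (jnorm_pos y).le _)])
    (fun y => by rw [one_mul, abs_of_nonneg (Real.rpow_nonneg (jnorm_pos y).le _)]) x
  rw [mul_one, mul_one] at h1
  exact (le_abs_self _).trans h1

/-- **(5.1), case `a ≥ b > d`**: `Σ_y ⟦x-y⟧^{-a}⟦y⟧^{-b} ≤ C⟦x⟧^{-b}` (pointwise,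
`⟦x⟧ ≤ 2(⟦x-y⟧ ∨ ⟦y⟧)` gives `⟦x-y⟧^{-a}⟦y⟧^{-b} ≤ 2^b⟦x⟧^{-b}(⟦y⟧^{-b} + ⟦x-y⟧^{-a})`, and both
kernels are summable). [cite: Sakai2007, Proposition 5.1 (5.1)]
[cite: HaraHofstadSlade2003, Prop. 1.7 (i)] -/
theorem exists_conv_jnorm_le_of_dim_lt {a b : ℝ} (hb : (d : ℝ) < b) (hba : b ≤ a) :
    ∃ C : ℝ, 0 ≤ C ∧ ∀ x : Site d, ∑' y, jnorm (x - y) ^ (-a) * jnorm y ^ (-b) ≤ C * jnorm x ^ (-b) := by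
  have ha : (d : ℝ) < a := hb.trans_le hba
  have hb0 : 0 ≤ b := (Nat.cast_nonneg d).trans hb.le
  have hsa := summable_jnorm_rpow_neg ha
  have hsb := summable_jnorm_rpow_neg hb
  set Sa := ∑' z : Site d, jnorm z ^ (-a)
  set Sb := ∑' z : Site d, jnorm z ^ (-b)
  have hSa : 0 ≤ Sa := tsum_nonneg fun z => Real.rpow_nonneg (jnorm_pos z).le _
  have hSb : 0 ≤ Sb := tsum_nonneg fun z => Real.rpow_nonneg (jnorm_pos z).le _
  refine ⟨2 ^ b * (Sb + Sa), by positivity, fun x => ?_⟩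
  have hx := jnorm_pos x
  -- pointwise domination
  have hpt : ∀ y, jnorm (x - y) ^ (-a) * jnorm y ^ (-b) ≤
      2 ^ b * jnorm x ^ (-b) * (jnorm y ^ (-b) + jnorm (x - y) ^ (-a)) := by
    intro y
    have h1 : 0 ≤ jnorm (x - y) ^ (-a) := Real.rpow_nonneg (jnorm_pos _).le _
    have h2 : 0 ≤ jnorm y ^ (-b) := Real.rpow_nonneg (jnorm_pos _).le _
    have h3 : 0 ≤ 2 ^ b * jnorm x ^ (-b) := mul_nonneg (by positivity) (Real.rpow_nonneg hx.le _)
    have hmax : jnorm x ≤ 2 * max (jnorm (x - y)) (jnorm y) := by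
      have := jnorm_sub_le_two_mul_max x 0 y
      rwa [sub_zero, sub_zero] at this
    rcases le_total (jnorm y) (jnorm (x - y)) with h | h
    · rw [max_eq_left h] at hmax
      have hb1 := jnorm_rpow_neg_le_of_jnorm_le (by norm_num : (0:ℝ) < 2) hb0 hmax
      have hab : jnorm (x - y) ^ (-a) ≤ jnorm (x - y) ^ (-b) := jnorm_rpow_neg_antitone _ hba
      calc jnorm (x - y) ^ (-a) * jnorm y ^ (-b) ≤ (2 ^ b * jnorm x ^ (-b)) * jnorm y ^ (-b) :=
            mul_le_mul_of_nonneg_right (hab.trans hb1) h2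
        _ ≤ _ := mul_le_mul_of_nonneg_left (by linarith) h3
    · rw [max_eq_right h] at hmax
      have hb1 := jnorm_rpow_neg_le_of_jnorm_le (by norm_num : (0:ℝ) < 2) hb0 hmax
      calc jnorm (x - y) ^ (-a) * jnorm y ^ (-b) ≤ jnorm (x - y) ^ (-a) * (2 ^ b * jnorm x ^ (-b)) :=
            mul_le_mul_of_nonneg_left hb1 h1
        _ = (2 ^ b * jnorm x ^ (-b)) * jnorm (x - y) ^ (-a) := by ring
        _ ≤ _ := mul_le_mul_of_nonneg_left (by linarith) h3
  have hmaj : Summable fun y => 2 ^ b * jnorm x ^ (-b) * (jnorm y ^ (-b) + jnorm (x - y) ^ (-a)) :=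
    (hsb.add (summable_comp_sub_left hsa x)).mul_left _
  have hnn : ∀ y, 0 ≤ jnorm (x - y) ^ (-a) * jnorm y ^ (-b) := fun y =>
    mul_nonneg (Real.rpow_nonneg (jnorm_pos _).le _) (Real.rpow_nonneg (jnorm_pos _).le _)
  have hsum : Summable fun y => jnorm (x - y) ^ (-a) * jnorm y ^ (-b) :=
    Summable.of_nonneg_of_le hnn hpt hmaj
  calc ∑' y, jnorm (x - y) ^ (-a) * jnorm y ^ (-b)
      ≤ ∑' y, 2 ^ b * jnorm x ^ (-b) * (jnorm y ^ (-b) + jnorm (x - y) ^ (-a)) :=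
        Summable.tsum_le_tsum hpt hsum hmaj
    _ = 2 ^ b * jnorm x ^ (-b) * (Sb + Sa) := by
        rw [tsum_mul_left, Summable.tsum_add hsb (summable_comp_sub_left hsa x),
          tsum_comp_sub_left (fun z => jnorm z ^ (-a)) x]
    _ = 2 ^ b * (Sb + Sa) * jnorm x ^ (-b) := by ring

/-- **(5.1), case `b ≤ a < d < a + b`**: `Σ_y ⟦x-y⟧^{-a}⟦y⟧^{-b} ≤ C⟦x⟧^{d-a-b}` (three regions:
`|y| ≤ |x|/2`, where `⟦x-y⟧ ≥ ⟦x⟧/2` and `Σ_{|y| ≤ |x|/2}⟦y⟧^{-b} ≤ C⟦x⟧^{d-b}`;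
`|x|/2 < |y| ≤ 2|x|`, where `⟦y⟧ ≥ ⟦x⟧/2` and `Σ_{|x-y| ≤ 3|x|}⟦x-y⟧^{-a} ≤ C⟦x⟧^{d-a}`;
`|y| > 2|x|`, where `⟦x-y⟧ ≥ ⟦y⟧/2` and `Σ_{|y|>2|x|}⟦y⟧^{-(a+b)} ≤ C⟦x⟧^{d-a-b}`).
[cite: Sakai2007, Proposition 5.1 (5.1)] [cite: HaraHofstadSlade2003, Prop. 1.7 (i)] -/
theorem exists_conv_jnorm_le_rpow_sub (hd : 1 ≤ d) {a b : ℝ} (hb0 : 0 ≤ b) (hba : b ≤ a)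
    (had : a < d) (hab : (d : ℝ) < a + b) :
    ∃ C : ℝ, 0 ≤ C ∧ ∀ x : Site d,
      ∑' y, jnorm (x - y) ^ (-a) * jnorm y ^ (-b) ≤ C * jnorm x ^ ((d : ℝ) - a - b) := by
  have ha0 : 0 ≤ a := hb0.trans hba
  have hbd : b < d := lt_of_le_of_lt hba had
  obtain ⟨Cb, hCb, hballb⟩ := exists_tsum_ball_jnorm_rpow_neg_le hd hb0 hbd
  obtain ⟨Ca, hCa, hballa⟩ := exists_tsum_ball_jnorm_rpow_neg_le hd ha0 had
  obtain ⟨Ct, hCt, htail⟩ := exists_tsum_tail_jnorm_rpow_neg_le hd hab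
  refine ⟨2 ^ a * Cb + 2 ^ b * 3 ^ ((d : ℝ) - a) * Ca + 2 ^ a * Ct, by positivity, fun x => ?_⟩
  have hx := jnorm_pos x
  have hx1 := one_le_jnorm x
  have hxe := euclidNorm_le_jnorm x
  have he0 := euclidNorm_nonneg x
  set s : Set (Site d) := {y | euclidNorm y ≤ euclidNorm x / 2} with hs_def
  set t : Set (Site d) := {y | euclidNorm y ≤ 2 * euclidNorm x} with ht_def
  set u : Set (Site d) := {z | euclidNorm z ≤ 3 * euclidNorm x} with hu_def
  -- the three majorants
  set G₁ : Site d → ℝ := fun y => 2 ^ a * jnorm x ^ (-a) * s.indicator (fun y => jnorm y ^ (-b)) y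
  set G₂ : Site d → ℝ := fun y => 2 ^ b * jnorm x ^ (-b) * u.indicator (fun z => jnorm z ^ (-a)) (x - y)
  set G₃ : Site d → ℝ := fun y => 2 ^ a * tᶜ.indicator (fun y => jnorm y ^ (-(a + b))) y
  have hG₁ : ∀ y, 0 ≤ G₁ y := fun y => mul_nonneg (mul_nonneg (by positivity) (Real.rpow_nonneg hx.le _))
    (Set.indicator_nonneg (fun _ _ => Real.rpow_nonneg (jnorm_pos _).le _) _)
  have hG₂ : ∀ y, 0 ≤ G₂ y := fun y => mul_nonneg (mul_nonneg (by positivity) (Real.rpow_nonneg hx.le _))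
    (Set.indicator_nonneg (fun _ _ => Real.rpow_nonneg (jnorm_pos _).le _) _)
  have hG₃ : ∀ y, 0 ≤ G₃ y := fun y => mul_nonneg (by positivity)
    (Set.indicator_nonneg (fun _ _ => Real.rpow_nonneg (jnorm_pos _).le _) _)
  -- pointwise domination
  have hpt : ∀ y, jnorm (x - y) ^ (-a) * jnorm y ^ (-b) ≤ G₁ y + G₂ y + G₃ y := by
    intro y
    have h1 : 0 ≤ jnorm (x - y) ^ (-a) := Real.rpow_nonneg (jnorm_pos _).le _
    have h2 : 0 ≤ jnorm y ^ (-b) := Real.rpow_nonneg (jnorm_pos _).le _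
    by_cases hys : y ∈ s
    · -- region 1
      have hy' : euclidNorm y ≤ euclidNorm x / 2 := hys
      have hxy : jnorm x ≤ 2 * jnorm (x - y) :=
        jnorm_le_mul_jnorm (by norm_num) (by linarith [euclidNorm_le_sub_add x y])
      have hk := jnorm_rpow_neg_le_of_jnorm_le (by norm_num : (0:ℝ) < 2) ha0 hxy
      have : jnorm (x - y) ^ (-a) * jnorm y ^ (-b) ≤ G₁ y := by
        simp only [G₁, Set.indicator_of_mem hys]
        calc jnorm (x - y) ^ (-a) * jnorm y ^ (-b) ≤ (2 ^ a * jnorm x ^ (-a)) * jnorm y ^ (-b) :=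
              mul_le_mul_of_nonneg_right hk h2
          _ = _ := by ring
      linarith [hG₂ y, hG₃ y]
    · have hy' : euclidNorm x / 2 < euclidNorm y := not_le.1 hys
      by_cases hyt : y ∈ t
      · -- region 2
        have hy2 : euclidNorm y ≤ 2 * euclidNorm x := hyt
        have hxy : jnorm x ≤ 2 * jnorm y := jnorm_le_mul_jnorm (by norm_num) (by linarith)
        have hk := jnorm_rpow_neg_le_of_jnorm_le (by norm_num : (0:ℝ) < 2) hb0 hxy
        have hxu : x - y ∈ u := by
          show euclidNorm (x - y) ≤ 3 * euclidNorm x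
          have := euclidNorm_add_le x (-y)
          rw [← sub_eq_add_neg, euclidNorm_neg] at this
          linarith
        have : jnorm (x - y) ^ (-a) * jnorm y ^ (-b) ≤ G₂ y := by
          simp only [G₂, Set.indicator_of_mem hxu]
          calc jnorm (x - y) ^ (-a) * jnorm y ^ (-b) ≤ jnorm (x - y) ^ (-a) * (2 ^ b * jnorm x ^ (-b)) :=
                mul_le_mul_of_nonneg_left hk h1
            _ = _ := by ring
        linarith [hG₁ y, hG₃ y]
      · -- region 3
        have hy2 : 2 * euclidNorm x < euclidNorm y := not_le.1 hyt
        have hxy : jnorm y ≤ 2 * jnorm (x - y) := by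
          refine jnorm_le_mul_jnorm (by norm_num) ?_
          have := euclidNorm_le_sub_add y x
          rw [euclidNorm_sub_rev] at this
          linarith
        have hk := jnorm_rpow_neg_le_of_jnorm_le (by norm_num : (0:ℝ) < 2) ha0 hxy
        have hyc : y ∈ tᶜ := hyt
        have : jnorm (x - y) ^ (-a) * jnorm y ^ (-b) ≤ G₃ y := by
          simp only [G₃, Set.indicator_of_mem hyc]
          calc jnorm (x - y) ^ (-a) * jnorm y ^ (-b) ≤ (2 ^ a * jnorm y ^ (-a)) * jnorm y ^ (-b) :=
                mul_le_mul_of_nonneg_right hk h2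
            _ = 2 ^ a * jnorm y ^ (-(a + b)) := by
                rw [mul_assoc, jnorm_rpow_mul_rpow]; ring_nf
        linarith [hG₁ y, hG₂ y]
  -- summability of the majorants
  have hsG₁ : Summable G₁ := (summable_indicator_ball _ _).mul_left _
  have hsG₂ : Summable G₂ := by
    have := summable_comp_sub_left (summable_indicator_ball (3 * euclidNorm x) (fun z => jnorm z ^ (-a))) x
    exact this.mul_left _
  have hsG₃ : Summable G₃ := (summable_indicator_compl_ball hab _).mul_left _
  have hnn : ∀ y, 0 ≤ jnorm (x - y) ^ (-a) * jnorm y ^ (-b) := fun y =>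
    mul_nonneg (Real.rpow_nonneg (jnorm_pos _).le _) (Real.rpow_nonneg (jnorm_pos _).le _)
  have hsum : Summable fun y => jnorm (x - y) ^ (-a) * jnorm y ^ (-b) :=
    Summable.of_nonneg_of_le hnn hpt ((hsG₁.add hsG₂).add hsG₃)
  -- the three sums
  have hS₁ : ∑' y, G₁ y ≤ 2 ^ a * Cb * jnorm x ^ ((d : ℝ) - a - b) := by
    simp only [G₁]
    rw [tsum_mul_left]
    have h2 := hballb (euclidNorm x / 2)
    have h3 : (max (euclidNorm x / 2) 1) ^ ((d : ℝ) - b) ≤ jnorm x ^ ((d : ℝ) - b) :=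
      max_div_one_rpow_le x (by norm_num) (by linarith)
    calc 2 ^ a * jnorm x ^ (-a) * ∑' y, s.indicator (fun y => jnorm y ^ (-b)) y
        ≤ 2 ^ a * jnorm x ^ (-a) * (Cb * jnorm x ^ ((d : ℝ) - b)) :=
          mul_le_mul_of_nonneg_left (h2.trans (mul_le_mul_of_nonneg_left h3 hCb))
            (mul_nonneg (by positivity) (Real.rpow_nonneg hx.le _))
      _ = 2 ^ a * Cb * (jnorm x ^ (-a) * jnorm x ^ ((d : ℝ) - b)) := by ring
      _ = 2 ^ a * Cb * jnorm x ^ ((d : ℝ) - a - b) := by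
          rw [jnorm_rpow_mul_rpow]; ring_nf
  have hS₂ : ∑' y, G₂ y ≤ 2 ^ b * 3 ^ ((d : ℝ) - a) * Ca * jnorm x ^ ((d : ℝ) - a - b) := by
    simp only [G₂]
    rw [tsum_mul_left, tsum_comp_sub_left (u.indicator fun z => jnorm z ^ (-a)) x]
    have h2 := hballa (3 * euclidNorm x)
    have h3 : (max (3 * euclidNorm x) 1) ^ ((d : ℝ) - a) ≤ (3 * jnorm x) ^ ((d : ℝ) - a) := by
      refine Real.rpow_le_rpow (by positivity) (max_le (by linarith) (by linarith)) (by linarith)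
    rw [Real.mul_rpow (by norm_num) hx.le] at h3
    calc 2 ^ b * jnorm x ^ (-b) * ∑' z, u.indicator (fun z => jnorm z ^ (-a)) z
        ≤ 2 ^ b * jnorm x ^ (-b) * (Ca * (3 ^ ((d : ℝ) - a) * jnorm x ^ ((d : ℝ) - a))) :=
          mul_le_mul_of_nonneg_left (h2.trans (mul_le_mul_of_nonneg_left h3 hCa))
            (mul_nonneg (by positivity) (Real.rpow_nonneg hx.le _))
      _ = 2 ^ b * 3 ^ ((d : ℝ) - a) * Ca * (jnorm x ^ (-b) * jnorm x ^ ((d : ℝ) - a)) := by ring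
      _ = 2 ^ b * 3 ^ ((d : ℝ) - a) * Ca * jnorm x ^ ((d : ℝ) - a - b) := by
          rw [jnorm_rpow_mul_rpow]; ring_nf
  have hS₃ : ∑' y, G₃ y ≤ 2 ^ a * Ct * jnorm x ^ ((d : ℝ) - a - b) := by
    simp only [G₃]
    rw [tsum_mul_left]
    have h2 := htail (2 * euclidNorm x)
    have h3 : (max (2 * euclidNorm x) 1) ^ ((d : ℝ) - (a + b)) ≤ jnorm x ^ ((d : ℝ) - a - b) := by
      have : (d : ℝ) - (a + b) = (d : ℝ) - a - b := by ring
      rw [this]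
      refine Real.rpow_le_rpow_of_nonpos hx ?_ (by linarith)
      exact max_le_max (by linarith) le_rfl
    calc 2 ^ a * ∑' y, tᶜ.indicator (fun y => jnorm y ^ (-(a + b))) y
        ≤ 2 ^ a * (Ct * jnorm x ^ ((d : ℝ) - a - b)) :=
          mul_le_mul_of_nonneg_left (h2.trans (mul_le_mul_of_nonneg_left h3 hCt)) (by positivity)
      _ = 2 ^ a * Ct * jnorm x ^ ((d : ℝ) - a - b) := by ring
  calc ∑' y, jnorm (x - y) ^ (-a) * jnorm y ^ (-b)
      ≤ ∑' y, (G₁ y + G₂ y + G₃ y) := Summable.tsum_le_tsum hpt hsum ((hsG₁.add hsG₂).add hsG₃)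
    _ = ∑' y, G₁ y + ∑' y, G₂ y + ∑' y, G₃ y := by
        rw [Summable.tsum_add (hsG₁.add hsG₂) hsG₃, Summable.tsum_add hsG₁ hsG₂]
    _ ≤ 2 ^ a * Cb * jnorm x ^ ((d : ℝ) - a - b) + 2 ^ b * 3 ^ ((d : ℝ) - a) * Ca * jnorm x ^ ((d : ℝ) - a - b)
          + 2 ^ a * Ct * jnorm x ^ ((d : ℝ) - a - b) := add_le_add (add_le_add hS₁ hS₂) hS₃
    _ = (2 ^ a * Cb + 2 ^ b * 3 ^ ((d : ℝ) - a) * Ca + 2 ^ a * Ct) * jnorm x ^ ((d : ℝ) - a - b) := by ring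

/-- Summability of the kernel convolution `⟦x-·⟧^{-a}⟦·⟧^{-b}` for `a, b ≥ 0`, `a + b > d`.
[folklore] -/
theorem summable_conv_jnorm {a b : ℝ} (ha : 0 ≤ a) (hb : 0 ≤ b) (h : (d : ℝ) < a + b) (x : Site d) :
    Summable fun y => jnorm (x - y) ^ (-a) * jnorm y ^ (-b) :=
  (summable_jnorm_conv ha hb h x).1

/-! ### The kernels as extended nonnegative reals -/

/-- The regularised Riesz kernel `⟦x⟧^{-s}` as an extended nonnegative real (the currency of the
diagram estimates: lattice sums of nonnegative terms, no summability side conditions).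
[cite: Sakai2007, §3 (⟦x⟧ = |x| ∨ 1) and Proposition 5.1] -/
def jker (s : ℝ) (x : Site d) : ℝ≥0∞ := ENNReal.ofReal (jnorm x ^ (-s))

/-- Unfolding `jker`. [folklore] -/
theorem jker_def (s : ℝ) (x : Site d) : jker s x = ENNReal.ofReal (jnorm x ^ (-s)) := rfl

/-- `⟦-x⟧^{-s} = ⟦x⟧^{-s}`. [folklore] -/
theorem jker_neg (s : ℝ) (x : Site d) : jker s (-x) = jker s x := by
  rw [jker, jker, jnorm_neg]

/-- `⟦x-y⟧^{-s} = ⟦y-x⟧^{-s}`. [folklore] -/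
theorem jker_sub_rev (s : ℝ) (x y : Site d) : jker s (x - y) = jker s (y - x) := by
  rw [jker, jker, jnorm_sub_rev]

/-- `⟦0⟧^{-s} = 1`. [folklore] -/
@[simp] theorem jker_zero (s : ℝ) : jker s (0 : Site d) = 1 := by
  simp [jker]

/-- The kernel is finite. [folklore] -/
theorem jker_ne_top (s : ℝ) (x : Site d) : jker s x ≠ ⊤ := ENNReal.ofReal_ne_top

/-- The kernel is finite. [folklore] -/
theorem jker_lt_top (s : ℝ) (x : Site d) : jker s x < ⊤ := ENNReal.ofReal_lt_top

/-- Back to the reals. [folklore] -/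
theorem toReal_jker (s : ℝ) (x : Site d) : (jker s x).toReal = jnorm x ^ (-s) :=
  ENNReal.toReal_ofReal (Real.rpow_nonneg (jnorm_pos x).le _)

/-- `⟦x⟧^{-s} ≤ 1` for `s ≥ 0`. [folklore] -/
theorem jker_le_one {s : ℝ} (hs : 0 ≤ s) (x : Site d) : jker s x ≤ 1 :=
  ENNReal.ofReal_le_one.2 (jnorm_rpow_neg_le_one x hs)

/-- `⟦x⟧^{-a} ≤ ⟦x⟧^{-b}` for `b ≤ a`. [folklore] -/
theorem jker_antitone {a b : ℝ} (h : b ≤ a) (x : Site d) : jker a x ≤ jker b x :=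
  ENNReal.ofReal_le_ofReal (jnorm_rpow_neg_antitone x h)

/-- `⟦x⟧^{-a}⟦x⟧^{-b} = ⟦x⟧^{-(a+b)}`. [folklore] -/
theorem jker_mul (a b : ℝ) (x : Site d) : jker a x * jker b x = jker (a + b) x := by
  rw [jker, jker, jker, ← ENNReal.ofReal_mul (Real.rpow_nonneg (jnorm_pos x).le _),
    jnorm_rpow_mul_rpow]
  congr 1; ring_nf

/-- A product of two kernels, as `ofReal` of the real product. [folklore] -/
theorem jker_mul_jker (a b : ℝ) (x y : Site d) :
    jker a x * jker b y = ENNReal.ofReal (jnorm x ^ (-a) * jnorm y ^ (-b)) := by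
  rw [jker, jker, ← ENNReal.ofReal_mul (Real.rpow_nonneg (jnorm_pos x).le _)]

/-- The `ℝ≥0∞`-valued convolution is `ofReal` of the real one (when the latter converges).
[folklore] -/
theorem tsum_jker_conv_eq_ofReal {a b : ℝ} {x : Site d}
    (hsum : Summable fun y => jnorm (x - y) ^ (-a) * jnorm y ^ (-b)) :
    ∑' y, jker a (x - y) * jker b y = ENNReal.ofReal (∑' y, jnorm (x - y) ^ (-a) * jnorm y ^ (-b)) := by
  rw [ENNReal.ofReal_tsum_of_nonneg (fun y => mul_nonneg (Real.rpow_nonneg (jnorm_pos _).le _)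
    (Real.rpow_nonneg (jnorm_pos _).le _)) hsum]
  exact tsum_congr fun y => jker_mul_jker a b (x - y) y

/-- `Σ_y ⟦y⟧^{-a} ⟦x-y⟧^{-b} = Σ_y ⟦x-y⟧^{-a} ⟦y⟧^{-b}` in `ℝ≥0∞`. [folklore] -/
theorem tsum_jker_comm (a b : ℝ) (x : Site d) :
    ∑' y, jker a y * jker b (x - y) = ∑' y, jker a (x - y) * jker b y := by
  rw [← (Equiv.subLeft x).tsum_eq (fun y => jker a y * jker b (x - y))]
  exact tsum_congr fun y => by simp [sub_sub_cancel]

/-- Translating the base point in `ℝ≥0∞`: `Σ_y ⟦x-y⟧^{-a} ⟦y-v⟧^{-b} = Σ_z ⟦(x-v)-z⟧^{-a} ⟦z⟧^{-b}`.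
[folklore] -/
theorem tsum_jker_shift (a b : ℝ) (x v : Site d) :
    ∑' y, jker a (x - y) * jker b (y - v) = ∑' z, jker a (x - v - z) * jker b z := by
  rw [← (Equiv.addRight v).tsum_eq (fun y => jker a (x - y) * jker b (y - v))]
  refine tsum_congr fun z => ?_
  have h1 : x - (z + v) = x - v - z := by abel
  simp [h1]

/-- **Two-point transfer**: a bound for the centred convolution gives the same bound for
`Σ_y ⟦x-y⟧^{-a}⟦y-v⟧^{-b}` as a function of `x - v` (translation invariance).
[cite: Sakai2007, Proposition 5.1 (5.1)] -/
theorem tsum_jker_two_point_le {a b : ℝ} {B : Site d → ℝ≥0∞}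
    (h : ∀ w : Site d, ∑' z, jker a (w - z) * jker b z ≤ B w) (x v : Site d) :
    ∑' y, jker a (x - y) * jker b (y - v) ≤ B (x - v) := by
  rw [tsum_jker_shift]; exact h (x - v)

/-- **Two-point transfer, Sakai's orientation** `Σ_y ⟦y-v⟧^{-a}⟦x-y⟧^{-b}`.
[cite: Sakai2007, Proposition 5.1 (5.1)] -/
theorem tsum_jker_two_point_le' {a b : ℝ} {B : Site d → ℝ≥0∞}
    (h : ∀ w : Site d, ∑' z, jker a z * jker b (w - z) ≤ B w) (x v : Site d) :
    ∑' y, jker a (y - v) * jker b (x - y) ≤ B (x - v) := by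
  have e : ∑' y, jker a (y - v) * jker b (x - y) = ∑' y, jker b (x - y) * jker a (y - v) :=
    tsum_congr fun y => mul_comm _ _
  rw [e, tsum_jker_shift]
  calc ∑' z, jker b (x - v - z) * jker a z = ∑' z, jker a z * jker b (x - v - z) :=
        tsum_congr fun z => mul_comm _ _
    _ ≤ B (x - v) := h (x - v)

/-! ### (5.1) for the `ℝ≥0∞` kernels -/

/-- **(5.1) in `ℝ≥0∞`, case `a > d > b ≥ 0`**: `Σ_y ⟦x-y⟧^{-a}⟦y⟧^{-b} ≤ C⟦x⟧^{-b}`.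
[cite: Sakai2007, Proposition 5.1 (5.1)] [cite: HaraHofstadSlade2003, Prop. 1.7 (i)] -/
theorem exists_conv_jker_le_of_lt_dim (hd : 1 ≤ d) {a b : ℝ} (ha : (d : ℝ) < a) (hb0 : 0 ≤ b)
    (hbd : b < d) :
    ∃ C : ℝ, 0 ≤ C ∧ ∀ x : Site d, ∑' y, jker a (x - y) * jker b y ≤ ENNReal.ofReal C * jker b x := by
  obtain ⟨C, hC, h⟩ := exists_conv_jnorm_le_of_lt_dim hd ha hb0 hbd
  have ha0 : 0 ≤ a := (Nat.cast_nonneg d).trans ha.le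
  refine ⟨C, hC, fun x => ?_⟩
  rw [tsum_jker_conv_eq_ofReal (summable_conv_jnorm ha0 hb0 (by linarith) x), jker,
    ← ENNReal.ofReal_mul hC]
  exact ENNReal.ofReal_le_ofReal (h x)

/-- **(5.1) in `ℝ≥0∞`, case `a ≥ b > d`**: `Σ_y ⟦x-y⟧^{-a}⟦y⟧^{-b} ≤ C⟦x⟧^{-b}`.
[cite: Sakai2007, Proposition 5.1 (5.1)] [cite: HaraHofstadSlade2003, Prop. 1.7 (i)] -/
theorem exists_conv_jker_le_of_dim_lt {a b : ℝ} (hb : (d : ℝ) < b) (hba : b ≤ a) :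
    ∃ C : ℝ, 0 ≤ C ∧ ∀ x : Site d, ∑' y, jker a (x - y) * jker b y ≤ ENNReal.ofReal C * jker b x := by
  obtain ⟨C, hC, h⟩ := exists_conv_jnorm_le_of_dim_lt (d := d) hb hba
  have hb0 : 0 ≤ b := (Nat.cast_nonneg d).trans hb.le
  refine ⟨C, hC, fun x => ?_⟩
  rw [tsum_jker_conv_eq_ofReal (summable_conv_jnorm (hb0.trans hba) hb0 (by linarith) x), jker,
    ← ENNReal.ofReal_mul hC]
  exact ENNReal.ofReal_le_ofReal (h x)

/-- **(5.1) in `ℝ≥0∞`, case `b ≤ a < d < a + b`**: `Σ_y ⟦x-y⟧^{-a}⟦y⟧^{-b} ≤ C⟦x⟧^{-(a+b-d)}`.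
[cite: Sakai2007, Proposition 5.1 (5.1)] [cite: HaraHofstadSlade2003, Prop. 1.7 (i)] -/
theorem exists_conv_jker_le_of_lt_lt (hd : 1 ≤ d) {a b : ℝ} (hb0 : 0 ≤ b) (hba : b ≤ a)
    (had : a < d) (hab : (d : ℝ) < a + b) :
    ∃ C : ℝ, 0 ≤ C ∧ ∀ x : Site d,
      ∑' y, jker a (x - y) * jker b y ≤ ENNReal.ofReal C * jker (a + b - d) x := by
  obtain ⟨C, hC, h⟩ := exists_conv_jnorm_le_rpow_sub hd hb0 hba had hab
  refine ⟨C, hC, fun x => ?_⟩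
  rw [tsum_jker_conv_eq_ofReal (summable_conv_jnorm (hb0.trans hba) hb0 hab x), jker,
    ← ENNReal.ofReal_mul hC]
  refine ENNReal.ofReal_le_ofReal ((h x).trans (le_of_eq ?_))
  congr 1; ring_nf

/-- **The bubble is bounded**: for `d/2 < q < d`, `Σ_z ⟦p-z⟧^{-q}⟦z-p'⟧^{-q} ≤ C` uniformly
("`⟦x-x'⟧^{d-2q} ≤ 1` because of `d/2 < q`"). [cite: Sakai2007, proof of Proposition 5.1] -/
theorem exists_bubble_jker_le (hd : 1 ≤ d) {q : ℝ} (hq : (d : ℝ) < 2 * q) (hqd : q < d) :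
    ∃ C : ℝ, 0 ≤ C ∧ ∀ p p' : Site d, ∑' z, jker q (p - z) * jker q (z - p') ≤ ENNReal.ofReal C := by
  have hq0 : 0 ≤ q := by
    have : (0 : ℝ) ≤ d := Nat.cast_nonneg d
    linarith
  obtain ⟨C, hC, h⟩ := exists_conv_jker_le_of_lt_lt hd hq0 le_rfl hqd (by linarith)
  refine ⟨C, hC, fun p p' => ?_⟩
  calc ∑' z, jker q (p - z) * jker q (z - p') ≤ ENNReal.ofReal C * jker (q + q - d) (p - p') :=
        tsum_jker_two_point_le h p p'
    _ ≤ ENNReal.ofReal C * 1 := by gcongr; exact jker_le_one (by linarith) _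
    _ = ENNReal.ofReal C := mul_one _

/-! ### Sakai 2007, Proposition 5.1 (5.2): the star bound -/

/-- The pointwise triangle bound in `ℝ≥0∞`:
`⟦x-z⟧^{-q}⟦z-y⟧^{-q} ≤ 2^q⟦x-y⟧^{-q}(⟦x-z⟧^{-q} + ⟦z-y⟧^{-q})`.
[cite: Sakai2007, proof of Proposition 5.1] -/
theorem jker_mul_le_triangle (x y z : Site d) {q : ℝ} (hq : 0 ≤ q) :
    jker q (x - z) * jker q (z - y) ≤
      ENNReal.ofReal (2 ^ q) * jker q (x - y) * (jker q (x - z) + jker q (z - y)) := by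
  have h := jnorm_rpow_neg_mul_le_triangle x y z hq
  have n1 : 0 ≤ jnorm (x - z) ^ (-q) := Real.rpow_nonneg (jnorm_pos _).le _
  have n2 : 0 ≤ jnorm (z - y) ^ (-q) := Real.rpow_nonneg (jnorm_pos _).le _
  have n3 : 0 ≤ jnorm (x - y) ^ (-q) := Real.rpow_nonneg (jnorm_pos _).le _
  have n4 : (0 : ℝ) ≤ 2 ^ q := by positivity
  rw [jker_mul_jker]
  refine (ENNReal.ofReal_le_ofReal h).trans (le_of_eq ?_)
  rw [ENNReal.ofReal_mul (mul_nonneg n4 n3), ENNReal.ofReal_mul n4, ENNReal.ofReal_add n1 n2]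
  rfl

/-- **Sakai 2007, Proposition 5.1 (5.2), the star bound**: for `d/2 < q < d` there is
`C' = C'(d, q)` with
`Σ_z ⟦x-z⟧^{-q}⟦x'-z⟧^{-q}⟦z-y⟧^{-q}⟦z-y'⟧^{-q} ≤ C'⟦x-y⟧^{-q}⟦x'-y'⟧^{-q}` for all `x, x', y, y'`
(the two triangle inequalities `½⟦x-y⟧ ≤ ⟦x-z⟧ ∨ ⟦z-y⟧`, `½⟦x'-y'⟧ ≤ ⟦x'-z⟧ ∨ ⟦z-y'⟧` leave four
bubbles `Σ_z ⟦p-z⟧^{-q}⟦z-p'⟧^{-q} ≤ c⟦p-p'⟧^{d-2q} ≤ c`).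
[cite: Sakai2007, Proposition 5.1 (5.2) and its proof] -/
theorem exists_star_jker_le (hd : 1 ≤ d) {q : ℝ} (hq : (d : ℝ) < 2 * q) (hqd : q < d) :
    ∃ C : ℝ, 0 ≤ C ∧ ∀ x x' y y' : Site d,
      ∑' z, jker q (x - z) * jker q (x' - z) * jker q (z - y) * jker q (z - y') ≤
        ENNReal.ofReal C * (jker q (x - y) * jker q (x' - y')) := by
  have hq0 : 0 ≤ q := by
    have : (0 : ℝ) ≤ d := Nat.cast_nonneg d
    linarith
  obtain ⟨Cb, hCb, hbub⟩ := exists_bubble_jker_le hd hq hqd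
  refine ⟨2 ^ q * 2 ^ q * (4 * Cb), by positivity, fun x x' y y' => ?_⟩
  set c : ℝ≥0∞ := ENNReal.ofReal (2 ^ q) with hc
  set K := jker q (x - y)
  set K' := jker q (x' - y')
  -- pointwise
  have hpt : ∀ z, jker q (x - z) * jker q (x' - z) * jker q (z - y) * jker q (z - y') ≤
      c * c * (K * K') * (jker q (x - z) * jker q (x' - z) + jker q (x - z) * jker q (z - y')
        + jker q (z - y) * jker q (x' - z) + jker q (z - y) * jker q (z - y')) := by
    intro z
    have h1 := jker_mul_le_triangle x y z hq0
    have h2 := jker_mul_le_triangle x' y' z hq0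
    calc jker q (x - z) * jker q (x' - z) * jker q (z - y) * jker q (z - y')
        = (jker q (x - z) * jker q (z - y)) * (jker q (x' - z) * jker q (z - y')) := by ring
      _ ≤ (c * K * (jker q (x - z) + jker q (z - y))) * (c * K' * (jker q (x' - z) + jker q (z - y'))) :=
          mul_le_mul' h1 h2
      _ = _ := by ring
  -- the four bubbles
  have hb1 : ∑' z, jker q (x - z) * jker q (x' - z) ≤ ENNReal.ofReal Cb := by
    calc ∑' z, jker q (x - z) * jker q (x' - z) = ∑' z, jker q (x - z) * jker q (z - x') :=
          tsum_congr fun z => by rw [jker_sub_rev q x' z]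
      _ ≤ ENNReal.ofReal Cb := hbub x x'
  have hb2 : ∑' z, jker q (x - z) * jker q (z - y') ≤ ENNReal.ofReal Cb := hbub x y'
  have hb3 : ∑' z, jker q (z - y) * jker q (x' - z) ≤ ENNReal.ofReal Cb := by
    calc ∑' z, jker q (z - y) * jker q (x' - z) = ∑' z, jker q (x' - z) * jker q (z - y) :=
          tsum_congr fun z => mul_comm _ _
      _ ≤ ENNReal.ofReal Cb := hbub x' y
  have hb4 : ∑' z, jker q (z - y) * jker q (z - y') ≤ ENNReal.ofReal Cb := by
    calc ∑' z, jker q (z - y) * jker q (z - y') = ∑' z, jker q (y - z) * jker q (z - y') :=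
          tsum_congr fun z => by rw [jker_sub_rev q z y]
      _ ≤ ENNReal.ofReal Cb := hbub y y'
  have hC : ENNReal.ofReal (2 ^ q * 2 ^ q * (4 * Cb)) = c * c * (4 * ENNReal.ofReal Cb) := by
    rw [ENNReal.ofReal_mul (by positivity), ENNReal.ofReal_mul (by positivity),
      ENNReal.ofReal_mul (by norm_num), ENNReal.ofReal_ofNat]
  calc ∑' z, jker q (x - z) * jker q (x' - z) * jker q (z - y) * jker q (z - y')
      ≤ ∑' z, c * c * (K * K') * (jker q (x - z) * jker q (x' - z) + jker q (x - z) * jker q (z - y')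
        + jker q (z - y) * jker q (x' - z) + jker q (z - y) * jker q (z - y')) := ENNReal.tsum_le_tsum hpt
    _ = c * c * (K * K') * (∑' z, jker q (x - z) * jker q (x' - z) + ∑' z, jker q (x - z) * jker q (z - y')
        + ∑' z, jker q (z - y) * jker q (x' - z) + ∑' z, jker q (z - y) * jker q (z - y')) := by
        rw [ENNReal.tsum_mul_left, ENNReal.tsum_add, ENNReal.tsum_add, ENNReal.tsum_add]
    _ ≤ c * c * (K * K') * (ENNReal.ofReal Cb + ENNReal.ofReal Cb + ENNReal.ofReal Cb + ENNReal.ofReal Cb) := by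
        gcongr
    _ = ENNReal.ofReal (2 ^ q * 2 ^ q * (4 * Cb)) * (K * K') := by
        rw [hC]; ring

end Literature.Barriers.CriticalPhenomena
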